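import Literature.NumberTheory.EllipticCurves.PAdicLFunctionQuadraticTwistCongruenceAtTwoSharedPrimesProofs
import Literature.NumberTheory.DiophantineGeometry.ConductorExponentLeTwoProofs
import HarnessLib

/-!
# Route `AlignedTransportAtTwo`, crux C1 `MainConjectureTransportAlignedAtTwo` (stmt-BirchSwinnertonDyer-22296), line `birth` —
# the BOTH-ADDITIVE twist sub-cell, part 3a (COEFFICIENTS): `aₙ(E^{(d)}) = χ_d(n)aₙ(E)` when the TWIST is additive at the
# primes of `d`, and the conductor of a both-additive twist (`N_{E^{(d)}} = N_E` when every prime of `d` is `≥ 5`)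

HONEST FRAMING (cell `bsd-f1-sign2`, WIDTH-5 attach seat `bsd-line-att-p4` g9, under the lead `bsd-line-att-p1`). BSD is NOT
proved; C1 is NOT closed. THEOREMS ONLY; nothing asserted; `--supports stmt-BirchSwinnertonDyer-22296 --as helper`.
The tree's Birch lemma for the pair `(f_W, f_A)`, `A` a minimal model of `W^{(d)}`
(`…QuadraticTwistBirchSharedPrimesProofs`), assumes `W` GOOD OR MULTIPLICATIVE at the primes of `d`; its proof uses that
hypothesis only to know that the TWIST is additive there (`aₙ` identity) and that `N_W ∣ N_A`, `d² ∣ N_A`. Both hold in the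
BOTH-ADDITIVE case as well:

* §1 `LFunction_quadraticTwist_apply_of_twist_additive` — `aₙ(E^{(D)}) = (n/|D|)·aₙ(E)` for ALL `n` as soon as `E^{(D)}` is
  additive at every prime of `D` (`D ≡ 1 (mod 4)` square-free): both sides vanish at the multiples of such primes.
* §2 `conductorNorm_quadraticTwist_eq_of_additive` — for a prime `ℓ ≥ 5` at which BOTH `E` and `E^{(ℓ)}` are additive,
  `N_{E^{(ℓ)}} = N_E` (`f_ℓ = 2` on both sides: `two_le_conductorExponent_iff`, `conductorExponent_le_two_of_five_le_natGenerator`;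
  equality away from `ℓ`: `factorization_conductorNorm_quadraticTwist_eq_of_not_dvd`); hence `N_W ∣ N_A`, `ℓ² ∣ N_A`.
* companion `…AddTwistBirch` (§3–§4): the newform of `A` is `charTwist N_A f_W`, Birch's symbol relation with the period
  identity, `A` good ordinary at `2` with `α_A = χ(2)α_W`, and `L₂(f_A, α_A) = C(c)·(1+T)^{−f_d}·L₂(f_W, d, α_W, χ_d)`.

References: [MazurTateTeitelbaum1986Invent] §I.8, §I.11–I.13; [Shimura1971] Prop. 3.64; [AtkinLehner1970] §6; [SilvermanAEC2009]
VII.5 Prop. 5.1, X.2, App. C §16; [Silverman1994] IV.10.2, IV.10.4; [Matsuno2000] §2 (p. 84).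
-/

set_option autoImplicit false
set_option linter.dupNamespace false

noncomputable section

open scoped Classical MatrixGroups ModularForm NumberTheorySymbols

open CongruenceSubgroup NumberField IsDedekindDomain IsDedekindDomain.HeightOneSpectrum Rat.HeightOneSpectrum
  WeierstrassCurve PowerSeries Literature.NumberTheory.EllipticCurves Literature.NumberTheory.EllipticCurves.ModularForms
  Literature.NumberTheory.EllipticCurves.GreenbergVatsal2000

namespace Summit.BirchSwinnertonDyer.BirchSwinnertonDyer.Theorems.AlignedTransportAtTwoAddTwistCoefficients

/-! ## §1 `aₙ(E^{(D)}) = (n/|D|) aₙ(E)` when the TWIST is additive at the primes of `D` -/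

section Coefficients

variable (W : WeierstrassCurve ℚ) [W.IsElliptic]

/-- **`aₙ(E^{(D)}) = (n / |D|) aₙ(E)` for all `n`**, for `W/ℚ`, an odd fundamental discriminant `D` (`D ≡ 1 (mod 4)` square-free)
such that the TWIST `W^{(D)}` has ADDITIVE reduction at every place over a prime of `D` (e.g. `W` good or multiplicative there —
the tree's `LFunction_quadraticTwist_apply_of_isGloballyMinimal_sqfreeAt` — OR `W` itself additive there with an additive twist):
at such a place `L_v(E^{(D)}, T) = 1`, matching `χ_D(ℓ) = 0`; the unramified places as in the tree. Same proof as the tree's,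
with the additivity taken as the hypothesis. [cite: SilvermanAEC2009, X.2 and Exercise 10.16] -/
theorem LFunction_quadraticTwist_apply_of_twist_additive {D : ℤ} (hD4 : D % 4 = 1) (hsq : Squarefree D)
    (hadd : ∀ v : HeightOneSpectrum (𝓞 ℚ), ((primesEquiv v : ℕ) : ℤ) ∣ D →
      (W.quadraticTwist (D : ℚ)).HasAdditiveReductionAt v)
    (n : ℕ) :
    (W.quadraticTwist (D : ℚ)).LFunction n = J((n : ℤ) | D.natAbs) * W.LFunction n := by
  have hD0 : D ≠ 0 := by rintro rfl; norm_num at hD4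
  have hDq : (D : ℚ) ≠ 0 := by exact_mod_cast hD0
  haveI : (W.quadraticTwist (D : ℚ)).IsElliptic := W.isElliptic_quadraticTwist hDq
  rw [LFunction_eq_eulerProduct, LFunction_eq_eulerProduct]
  refine ArithmeticFunction.eulerProduct_apply_eq_mul_of_forall (P := fun _ ↦ True)
    (fun _ _ _ ↦ ⟨trivial, trivial⟩) (fun n : ℕ ↦ J((n : ℤ) | D.natAbs))
    (by exact_mod_cast jacobiSym.one_left D.natAbs)
    (fun m n ↦ by push_cast; exact jacobiSym.mul_left _ _ _) _ _ (fun v m _ ↦ ?_)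
    (eventually_cofinite_localEulerFactor_apply _) (eventually_cofinite_localEulerFactor_apply _) trivial
  haveI := Fact.mk (primesEquiv v).2
  have hℓ1 : 1 < (primesEquiv v : ℕ) := (primesEquiv v).2.one_lt
  by_cases hvD : ((primesEquiv v : ℕ) : ℤ) ∣ D
  · -- ramified place: the factor of the twist is trivial and `χ_D(ℓ) = 0`
    haveI : NeZero D.natAbs := ⟨Int.natAbs_ne_zero.mpr hD0⟩
    have hJ0 : J(((primesEquiv v : ℕ) : ℤ) | D.natAbs) = 0 := by
      rw [jacobiSym.eq_zero_iff_not_coprime, Int.gcd_natCast_natCast]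
      intro hcop
      have hdvd : (primesEquiv v : ℕ) ∣ D.natAbs := Int.natCast_dvd.mp hvD
      exact (primesEquiv v).2.one_lt.ne' (Nat.Coprime.eq_one_of_dvd hcop hdvd)
    rw [localEulerFactor_eq_one_of_hasAdditiveReduction _ (hadd v hvD), ArithmeticFunction.one_apply]
    split_ifs with hm1
    · rw [hm1, localEulerFactor_apply_one, Nat.cast_one, jacobiSym.one_left, one_mul]
    · by_cases hpow : ∃ k, Nat.card (IsLocalRing.ResidueField (v.adicCompletionIntegers ℚ)) ^ k = m
      · obtain ⟨k, rfl⟩ := hpow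
        rw [natCard_residueField_adicCompletionIntegers] at hm1 ⊢
        have hk : k ≠ 0 := fun h ↦ hm1 (by rw [h, pow_zero])
        rw [Nat.cast_pow, jacobiSym.pow_left, hJ0, zero_pow hk, zero_mul]
      · rw [localEulerFactor_apply_eq_zero _ _ (by rwa [natCard_residueField_adicCompletionIntegers]) hpow,
          mul_zero]
  · -- unramified place
    have key : ((W.quadraticTwist (D : ℚ)).baseChange (v.adicCompletion ℚ)).localEulerFactor
        (v.adicCompletionIntegers ℚ) =
        ArithmeticFunction.ofPowerSeries (primesEquiv v : ℕ)
          (PowerSeries.rescale (J(((primesEquiv v : ℕ) : ℤ) | D.natAbs))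
            ((W.baseChange (v.adicCompletion ℚ)).localPowerSeries (v.adicCompletionIntegers ℚ))) := by
      by_cases hv2 : (primesEquiv v : ℕ) = 2
      · exact W.localEulerFactor_quadraticTwist_two_of_emod_four_eq_one hD4 v hv2
      · exact W.localEulerFactor_quadraticTwist_of_odd_of_not_dvd hD4 v hv2 hvD
    rw [key, localEulerFactor, natCard_residueField_adicCompletionIntegers]
    exact ArithmeticFunction.ofPowerSeries_rescale_apply hℓ1 (fun n : ℕ ↦ J((n : ℤ) | D.natAbs))
      (by exact_mod_cast jacobiSym.one_left D.natAbs)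
      (fun m n ↦ by push_cast; exact jacobiSym.mul_left _ _ _) _ m

variable {d : ℤ} {A : WeierstrassCurve ℚ}

/-- **`aₙ(A) = χ_d(n)·aₙ(W)`** for a model `A` of `W^{(d)}` additive at the primes of `d` (`d ≡ 1 (mod 4)` square-free).
[cite: SilvermanAEC2009, X.2 and Exercise 10.16] -/
theorem LFunction_twist_apply_of_twist_additive (hd4 : d % 4 = 1) (hsq : Squarefree d)
    (hadd : ∀ v : HeightOneSpectrum (𝓞 ℚ), ((primesEquiv v : ℕ) : ℤ) ∣ d →
      (W.quadraticTwist (d : ℚ)).HasAdditiveReductionAt v)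
    {C : VariableChange ℚ} (hA : C • W.quadraticTwist (d : ℚ) = A) (n : ℕ) :
    A.LFunction n = J((n : ℤ) | d.natAbs) * W.LFunction n := by
  have hd0 : (d : ℚ) ≠ 0 := by exact_mod_cast (show d ≠ 0 by rintro rfl; norm_num at hd4)
  haveI := W.isElliptic_quadraticTwist hd0
  rw [← hA, LFunction_smul]
  exact LFunction_quadraticTwist_apply_of_twist_additive W hd4 hsq hadd n

/-- The same in `ℂ` through the Jacobi character `χ` mod `m = |d|`: `aₙ(A) = χ(n)·aₙ(W)`. [cite: SilvermanAEC2009, X.2 and Exercise 10.16] -/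
theorem LFunction_twist_apply_complex_of_twist_additive (hd4 : d % 4 = 1) (hsq : Squarefree d)
    (hadd : ∀ v : HeightOneSpectrum (𝓞 ℚ), ((primesEquiv v : ℕ) : ℤ) ∣ d →
      (W.quadraticTwist (d : ℚ)).HasAdditiveReductionAt v)
    {C : VariableChange ℚ} (hA : C • W.quadraticTwist (d : ℚ) = A)
    [NeZero d.natAbs] {χ : MulChar (ZMod d.natAbs) ℤ} (hχ : ∀ a : ZMod d.natAbs, χ a = J((a.val : ℤ) | d.natAbs))
    (n : ℕ) : (A.LFunction n : ℂ) = (χ.ringHomComp (Int.castRingHom ℂ)) n * (W.LFunction n : ℂ) := by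
  rw [LFunction_twist_apply_of_twist_additive W hd4 hsq hadd hA n, Int.cast_mul, MulChar.ringHomComp_apply,
    mulChar_jacobi_apply_natCast hχ, eq_intCast]

end Coefficients

/-! ## §2 The conductor of a twist with every prime of `d` BOTH-ADDITIVE and `≥ 5`: `N_{E^{(d)}} = N_E` -/

section Conductor

variable (W : WeierstrassCurve ℚ) [W.IsElliptic]

/-- **`N_{E^{(d)}} = N_E` when at every prime `q ∣ d` one has `q ≥ 5` and BOTH `E`, `E^{(d)}` additive** (`d ≡ 1 (mod 4)`):
away from `d` the exponents agree (`factorization_conductorNorm_quadraticTwist_eq_of_not_dvd`); at `q ∣ d` both exponents are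
`2` (`f_q ≥ 2` iff additive, `two_le_conductorExponent_iff`; `f_q ≤ 2` for `q ≥ 5`, `conductorExponent_le_two_of_five_le_natGenerator`).
[cite: Silverman1994, IV.10.2(c) and IV.10.4] [cite: SilvermanAEC2009, App. C §16 (PDF pp. 390–391)] -/
theorem conductorNorm_quadraticTwist_eq_of_additive {d : ℤ} (hd4 : d % 4 = 1)
    (h5 : ∀ v : HeightOneSpectrum (𝓞 ℚ), ((primesEquiv v : ℕ) : ℤ) ∣ d → 5 ≤ (primesEquiv v : ℕ))
    (haddW : ∀ v : HeightOneSpectrum (𝓞 ℚ), ((primesEquiv v : ℕ) : ℤ) ∣ d → W.HasAdditiveReductionAt v)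
    (haddT : ∀ v : HeightOneSpectrum (𝓞 ℚ), ((primesEquiv v : ℕ) : ℤ) ∣ d →
      (W.quadraticTwist (d : ℚ)).HasAdditiveReductionAt v) :
    (haveI := W.isElliptic_quadraticTwist (show ((d : ℚ)) ≠ 0 by exact_mod_cast (show d ≠ 0 by omega));
      (W.quadraticTwist (d : ℚ)).conductorNorm ℤ) = W.conductorNorm ℤ := by
  have hd0 : d ≠ 0 := by omega
  have hdq : (d : ℚ) ≠ 0 := by exact_mod_cast hd0
  haveI := W.isElliptic_quadraticTwist hdq
  set N := W.conductorNorm ℤ with hN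
  set N' := (W.quadraticTwist (d : ℚ)).conductorNorm ℤ with hN'
  have hN0 : N ≠ 0 := (W.conductorNorm_pos_holds).ne'
  have hN'0 : N' ≠ 0 := ((W.quadraticTwist (d : ℚ)).conductorNorm_pos_holds).ne'
  have hgen : ∀ q : Nat.Primes, natGenerator ((primesEquiv (R := ℤ)).symm q) = q := fun q ↦
    congrArg (fun q : Nat.Primes ↦ (q : ℕ)) ((primesEquiv (R := ℤ)).apply_symm_apply q)
  refine Nat.eq_of_factorization_eq hN'0 hN0 fun q ↦ ?_
  by_cases hq : q.Prime
  swap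
  · rw [Nat.factorization_eq_zero_of_not_prime _ hq, Nat.factorization_eq_zero_of_not_prime _ hq]
  set vq : HeightOneSpectrum ℤ := (primesEquiv (R := ℤ)).symm ⟨q, hq⟩ with hvq
  have hgenq : natGenerator vq = q := by rw [hvq]; exact hgen ⟨q, hq⟩
  by_cases hqd : (q : ℤ) ∣ d
  · -- both exponents are `2`
    set w : HeightOneSpectrum (𝓞 ℚ) := (primesEquiv (R := 𝓞 ℚ)).symm ⟨q, hq⟩ with hw
    have hwq : (primesEquiv w : ℕ) = q := congrArg Subtype.val ((primesEquiv (R := 𝓞 ℚ)).apply_symm_apply ⟨q, hq⟩)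
    have hwd : ((primesEquiv w : ℕ) : ℤ) ∣ d := by rw [hwq]; exact hqd
    have hvw : vq = (primesEquiv (R := ℤ)).symm (primesEquiv w) := by
      rw [hvq]; congr 1; exact (Subtype.ext hwq).symm
    have hww : (primesEquiv (R := 𝓞 ℚ)).symm (primesEquiv w) = w := Equiv.symm_apply_apply _ w
    have haddWv : W.HasAdditiveReductionAt vq := by
      have h := W.hasAdditiveReductionAt_int_iff_ringOfIntegers (primesEquiv w)
      rw [hww, ← hvw] at h
      exact h.mpr (haddW w hwd)
    have haddTv : (W.quadraticTwist (d : ℚ)).HasAdditiveReductionAt vq := by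
      have h := (W.quadraticTwist (d : ℚ)).hasAdditiveReductionAt_int_iff_ringOfIntegers (primesEquiv w)
      rw [hww, ← hvw] at h
      exact h.mpr (haddT w hwd)
    have h5q : 5 ≤ natGenerator vq := by rw [hgenq, ← hwq]; exact h5 w hwd
    have hfW := factorization_conductorNorm_holds W vq
    have hfT := factorization_conductorNorm_holds (W.quadraticTwist (d : ℚ)) vq
    rw [hgenq] at hfW hfT
    rw [hfW, hfT]
    have h1 : W.conductorExponent vq = 2 :=
      le_antisymm (W.conductorExponent_le_two_of_five_le_natGenerator_holds vq h5q)
        ((two_le_conductorExponent_iff_holds vq W).mpr haddWv)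
    have h2 : (W.quadraticTwist (d : ℚ)).conductorExponent vq = 2 :=
      le_antisymm ((W.quadraticTwist (d : ℚ)).conductorExponent_le_two_of_five_le_natGenerator_holds vq h5q)
        ((two_le_conductorExponent_iff_holds vq _).mpr haddTv)
    rw [h1, h2]
  · have h := W.factorization_conductorNorm_quadraticTwist_eq_of_not_dvd hd4 vq (by rw [hgenq]; exact hqd)
    rw [hgenq] at h
    exact h

variable {d : ℤ} {A : WeierstrassCurve ℚ}

/-- **Conductor of a both-additive twist: `N_W ∣ N_A`, `d² ∣ N_A`, `2 ∤ N_W ⇒ 2 ∤ N_A`** for a model `A` of `W^{(d)}` (`N_A = N_W`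
by `conductorNorm_quadraticTwist_eq_of_additive`; `q² ∣ N_W` at the additive `q ∣ d`). The shape consumed by the Birch lemma.
[cite: Silverman1994, IV.10.2(c) and IV.10.4] [cite: AtkinLehner1970, §6] -/
theorem conductorNorm_twist_dvd_of_additive (hd4 : d % 4 = 1) (hsq : Squarefree d)
    (h5 : ∀ v : HeightOneSpectrum (𝓞 ℚ), ((primesEquiv v : ℕ) : ℤ) ∣ d → 5 ≤ (primesEquiv v : ℕ))
    (haddW : ∀ v : HeightOneSpectrum (𝓞 ℚ), ((primesEquiv v : ℕ) : ℤ) ∣ d → W.HasAdditiveReductionAt v)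
    (haddT : ∀ v : HeightOneSpectrum (𝓞 ℚ), ((primesEquiv v : ℕ) : ℤ) ∣ d →
      (W.quadraticTwist (d : ℚ)).HasAdditiveReductionAt v)
    {C : VariableChange ℚ} (hA : C • W.quadraticTwist (d : ℚ) = A) :
    W.conductorNorm ℤ ∣ A.conductorNorm ℤ ∧ d.natAbs ^ 2 ∣ A.conductorNorm ℤ ∧
      (¬ 2 ∣ W.conductorNorm ℤ → ¬ 2 ∣ A.conductorNorm ℤ) := by
  have hd0 : d ≠ 0 := by omega
  have hdq : (d : ℚ) ≠ 0 := by exact_mod_cast hd0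
  haveI := W.isElliptic_quadraticTwist hdq
  have hNA : A.conductorNorm ℤ = W.conductorNorm ℤ := by
    rw [← hA, WeierstrassCurve.conductorNorm_smul ℤ _ C]
    exact conductorNorm_quadraticTwist_eq_of_additive W hd4 h5 haddW haddT
  rw [hNA]
  refine ⟨dvd_rfl, ?_, id⟩
  set N := W.conductorNorm ℤ with hN
  have hN0 : N ≠ 0 := (W.conductorNorm_pos_holds).ne'
  have hda : d.natAbs ≠ 0 := Int.natAbs_ne_zero.mpr hd0
  have hgen : ∀ q : Nat.Primes, natGenerator ((primesEquiv (R := ℤ)).symm q) = q := fun q ↦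
    congrArg (fun q : Nat.Primes ↦ (q : ℕ)) ((primesEquiv (R := ℤ)).apply_symm_apply q)
  refine (Nat.factorization_le_iff_dvd (pow_ne_zero 2 hda) hN0).mp (Finsupp.le_def.mpr fun q ↦ ?_)
  rw [Nat.factorization_pow, Finsupp.smul_apply, smul_eq_mul]
  by_cases hq : q.Prime
  swap
  · rw [Nat.factorization_eq_zero_of_not_prime _ hq, mul_zero]; exact Nat.zero_le _
  by_cases hqd : (q : ℤ) ∣ d
  swap
  · have h0 : d.natAbs.factorization q = 0 :=
      Nat.factorization_eq_zero_of_not_dvd fun h ↦ hqd (Int.natCast_dvd.mpr h)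
    rw [h0, mul_zero]; exact Nat.zero_le _
  have hsq1 : d.natAbs.factorization q ≤ 1 :=
    Nat.squarefree_iff_factorization_le_one hda |>.mp (Int.squarefree_natAbs.mpr hsq) q
  set vq : HeightOneSpectrum ℤ := (primesEquiv (R := ℤ)).symm ⟨q, hq⟩ with hvq
  have hgenq : natGenerator vq = q := by rw [hvq]; exact hgen ⟨q, hq⟩
  set w : HeightOneSpectrum (𝓞 ℚ) := (primesEquiv (R := 𝓞 ℚ)).symm ⟨q, hq⟩ with hw
  have hwq : (primesEquiv w : ℕ) = q := congrArg Subtype.val ((primesEquiv (R := 𝓞 ℚ)).apply_symm_apply ⟨q, hq⟩)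
  have hwd : ((primesEquiv w : ℕ) : ℤ) ∣ d := by rw [hwq]; exact hqd
  have hvw : vq = (primesEquiv (R := ℤ)).symm (primesEquiv w) := by
    rw [hvq]; congr 1; exact (Subtype.ext hwq).symm
  have hww : (primesEquiv (R := 𝓞 ℚ)).symm (primesEquiv w) = w := Equiv.symm_apply_apply _ w
  have haddWv : W.HasAdditiveReductionAt vq := by
    have h := W.hasAdditiveReductionAt_int_iff_ringOfIntegers (primesEquiv w)
    rw [hww, ← hvw] at h
    exact h.mpr (haddW w hwd)
  have hfW := factorization_conductorNorm_holds W vq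
  rw [hgenq] at hfW
  calc 2 * d.natAbs.factorization q ≤ 2 * 1 := by gcongr
    _ ≤ N.factorization q := by
        rw [mul_one, hN, hfW]
        exact (two_le_conductorExponent_iff_holds vq W).mpr haddWv

end Conductor

end Summit.BirchSwinnertonDyer.BirchSwinnertonDyer.Theorems.AlignedTransportAtTwoAddTwistCoefficients

end
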